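import Literature.MathematicalPhysics.QuantumFieldTheory.Balaban1983to89.B12RTGaugeInvariance254
import Literature.MathematicalPhysics.QuantumFieldTheory.Balaban1983to89.B12SmallFieldDomain259
import Literature.MathematicalPhysics.QuantumFieldTheory.Balaban1983to89.T3UnitLawDensityEML

/-!
# `Balaban1983to89.AveragingImageLawGaugeInvariance` — the image law `Ū_*(dU)` of product Haar under ANY covariant averaging is
# invariant under the coarse gauge group; every single coarse bond variable is EXACTLY Haar distributed (the «E6′» question
# `Ū_*(dU) = dV` is confined to the joint law of cycle holonomies)

Cell `ym3-torus` (rung R3), seat `ym3-torus-p2` gen 12; bears on stmt-QuantumFields-19935 STUB 3′ conjunct (A), whose only remaining named leaf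
(fleet files `…RepAtHeightsUpperRow`, `T3AlphaInputsACTrivEnvelope.HaarCompatT3`) is EXACT HAAR COMPATIBILITY `Ū_*(dU) = dV` («E6′») of the block
averaging `BlockAveraging.blockAvg ℰp`; located memo `F-p2g12-1-E6prime-anatomy.md` (evidence on stmt-QuantumFields-19935/19936).

WHAT PRINT SAYS.  [Balaban1987RG1] p. 265 (after (2.1)): «The gauge covariance of the averages implies that the δ-functions in (2.1) are invariant
under the gauge transformations V → V^v, …» — in the tree the covariance is the field `Averaging.covariant` (`Ū(U^u) = (ŪU)^{u∘emb}`, [Balaban1985Averaging]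
(11) p.19) of EVERY `Setup.Averaging`, and `dU` is gauge invariant (`B12RTGaugeInvariance254.measurePreserving_gaugeAct`, [Balaban1985Averaging] (10)
p.19).  Exact Haar compatibility of the averaging is NOT IN PRINT (pub-balaban3d DEPMAP v6 §16; `B10Eq2HaarCompatibility`).

WHAT IS PROVED HERE (kernel bookkeeping; nothing of Bałaban's estimates is asserted, E6′ is neither proved nor refuted):
* §1 for EVERY averaging `av : Averaging P j G` in the standing range `j + 1 ≤ m + K` with measurable `av.avg`, every gauge group `G` with Haar data:
  `map_gaugeAct_imageLaw` — the image law `(dU).map Ū` is invariant under every COARSE gauge transformation `V ↦ V^v` (push-forward form of the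
  p. 265 sentence: realise `v` by the block-constant fine transformation `v ∘ blockOf`, use covariance and the invariance of `dU`);
  `map_mul_left_bondLaw` / `map_mul_right_bondLaw` — the law of ONE coarse bond variable `U ↦ Ū(U)(c)` is left- and right-translation invariant
  (gauge transformations concentrated at `c₋`, resp. `c₊`; `c₋ ≠ c₊` on every torus of the cell).
* §2 on a compact second-countable group two left-invariant probability measures coincide (`Measure.haarMeasure_unique`), hence
  `bondLaw_eq_haar` — **every single coarse bond variable of `Ū_*(dU)` is EXACTLY Haar distributed**, for every covariant averaging; in particular
  (§3, by name) for the T³ family's `blockAvg ℰp` on `SU(2)` at every level of the standing range (`bondLaw_blockAvgEp_eq_haar`), and the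
  `dU`-expectation of any integrable function of one coarse bond variable is its Haar integral (`integral_comp_avg_apply`).
* §4 «laundering»: `Haar ∗ₘ ν = ν(G)•Haar` and `ν ∗ₘ Haar = ν(G)•Haar` (Mathlib `Measure.mconv`) — an independent exactly-Haar factor makes a
  product exactly Haar, so a cycle holonomy with conditionally independent factors sees a defect only if EVERY factor is defective.
CONSEQUENCE FOR E6′ (recorded, not formalised): the same centre-site gauge transitivity makes the conditional forest terms of `T1 − 1` vanish, so
`Ū_*(dU) = dV` can fail only through the joint law of CYCLE holonomies (plaquettes on image tori of side ≥ 3, 2-cycles on side 2) — the pattern seen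
numerically (DEPMAP §16.5 (c1)/(c2); ym-instrument Q-C3).  No `sorry`, no new `def`/`instance`; standard axioms.

References: T. Bałaban, Commun. Math. Phys. 109 (1987) 249–301 [Balaban1987RG1] ((2.1) p.265, (0.5)–(0.6) p.253); T. Bałaban, Commun. Math. Phys.
98 (1985) 17–51 [Balaban1985Averaging] ((10)–(11) p.19); T. Bröcker, T. tom Dieck, Representations of Compact Lie Groups (1985) [BrockerTomDieck1985]
(I (5.12): uniqueness of normalised Haar measure).
-/

noncomputable section

open MeasureTheory

namespace Literature.MathematicalPhysics.QuantumFieldTheory.Balaban1983to89.AveragingImageLawGaugeInvariance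

open B12RTGaugeInvariance254 (liftTransf avg_gaugeAct_liftTransf measurable_gaugeAct measurePreserving_gaugeAct)

/-! ## §1 Coarse gauge invariance of the image law; translation invariance of single-bond laws -/

section Generic

variable {P : Params} {j : ℕ} {G : Type*} [GaugeGroup G] [MeasurableSpace G] [HaarData G] [MeasurableMul₂ G]

/-- **THE IMAGE LAW `Ū_*(dU)` IS INVARIANT UNDER THE COARSE GAUGE GROUP** — push-forward form of [Balaban1987RG1] p. 265 «The gauge covariance of
the averages implies that the δ-functions in (2.1) are invariant under the gauge transformations V → V^v»: for every averaging of the standing range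
with measurable `Ū` and every coarse gauge transformation `v`, `(V ↦ V^v)_*(Ū_*(dU)) = Ū_*(dU)` (realise `v` by `v ∘ blockOf`, `Averaging.covariant`,
gauge invariance of `dU`). [cite: Balaban1987RG1, (2.1) p.265] -/
theorem map_gaugeAct_imageLaw (hj : j + 1 ≤ P.m + P.K) (av : Averaging P j G) (havg : Measurable av.avg)
    (v : GaugeTransf P (j + 1) G) :
    ((fieldMeasure P j G).map av.avg).map (GaugeField.gaugeAct v) = (fieldMeasure P j G).map av.avg := by
  rw [Measure.map_map (measurable_gaugeAct v) havg]
  have hcomp : (GaugeField.gaugeAct v ∘ av.avg : GaugeField P j G → GaugeField P (j + 1) G) =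
      av.avg ∘ GaugeField.gaugeAct (liftTransf v) := by
    funext U
    exact (avg_gaugeAct_liftTransf hj av v U).symm
  rw [hcomp, ← Measure.map_map havg (measurable_gaugeAct _), (measurePreserving_gaugeAct (liftTransf v)).map_eq]

omit [MeasurableMul₂ G] in
/-- The image law `Ū_*(dU)` is a probability measure. [cite: Balaban1985Averaging, (10) p.19] -/
theorem isProbabilityMeasure_imageLaw (av : Averaging P j G) (havg : Measurable av.avg) :
    IsProbabilityMeasure ((fieldMeasure P j G).map av.avg) :=
  Measure.isProbabilityMeasure_map havg.aemeasurable

omit [GaugeGroup G] [HaarData G] [MeasurableMul₂ G] in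
/-- The coordinate `V ↦ V(c)` is measurable on coarse fields. [cite: Balaban1985Averaging, (10) p.19] -/
theorem measurable_apply_bond (c : PBond P (j + 1)) : Measurable fun V : GaugeField P (j + 1) G => V c :=
  measurable_pi_apply c

omit [MeasurableMul₂ G] in
/-- The law of ONE coarse bond variable `U ↦ Ū(U)(c)` under `dU`, as the `c`-marginal of the image law. [cite: Balaban1985Averaging, (10) p.19] -/
theorem map_avg_apply_eq (av : Averaging P j G) (havg : Measurable av.avg) (c : PBond P (j + 1)) :
    (fieldMeasure P j G).map (fun U => av.avg U c) = ((fieldMeasure P j G).map av.avg).map (fun V => V c) := by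
  rw [Measure.map_map (measurable_apply_bond c) havg]
  rfl

omit [MeasurableSpace G] [HaarData G] [MeasurableMul₂ G] in
/-- A coarse gauge transformation concentrated at the initial point `c₋` multiplies the bond variable `V(c)` on the LEFT (`c₋ ≠ c₊`).
[cite: Balaban1985Averaging, (8) p.19] -/
theorem gaugeAct_single_src_apply (c : PBond P (j + 1)) (g : G) (V : GaugeField P (j + 1) G) :
    GaugeField.gaugeAct (fun y => by classical exact if y = c.src then g else 1) V c = g * V c := by
  classical
  have hne : c.tgt ≠ c.src := fun h => B12SmallFieldDomain259.src_ne_tgt c h.symm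
  simp [GaugeField.gaugeAct, hne]

omit [MeasurableSpace G] [HaarData G] [MeasurableMul₂ G] in
/-- A coarse gauge transformation concentrated at the final point `c₊` multiplies the bond variable `V(c)` on the RIGHT by the inverse.
[cite: Balaban1985Averaging, (8) p.19] -/
theorem gaugeAct_single_tgt_apply (c : PBond P (j + 1)) (g : G) (V : GaugeField P (j + 1) G) :
    GaugeField.gaugeAct (fun y => by classical exact if y = c.tgt then g⁻¹ else 1) V c = V c * g := by
  classical
  have hne : c.src ≠ c.tgt := B12SmallFieldDomain259.src_ne_tgt c
  simp [GaugeField.gaugeAct, hne]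

/-- **THE LAW OF A SINGLE COARSE BOND VARIABLE IS LEFT-TRANSLATION INVARIANT**: for every averaging of the standing range with measurable `Ū`,
every coarse bond `c` and every `g ∈ G`, `(g·)_*Law(Ū(·)(c)) = Law(Ū(·)(c))` (the gauge transformation `g` at `c₋`; `c₋ ≠ c₊`).
[cite: Balaban1987RG1, (2.1) p.265] -/
theorem map_mul_left_bondLaw (hj : j + 1 ≤ P.m + P.K) (av : Averaging P j G) (havg : Measurable av.avg)
    (c : PBond P (j + 1)) (g : G) :
    ((fieldMeasure P j G).map (fun U => av.avg U c)).map (fun h => g * h) = (fieldMeasure P j G).map (fun U => av.avg U c) := by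
  classical
  set v : GaugeTransf P (j + 1) G := fun y => if y = c.src then g else 1 with hv
  have hcoord : (fun h : G => g * h) ∘ (fun V : GaugeField P (j + 1) G => V c) =
      (fun V : GaugeField P (j + 1) G => V c) ∘ GaugeField.gaugeAct v := by
    funext V
    simp only [Function.comp]
    rw [hv, gaugeAct_single_src_apply c g V]
  rw [map_avg_apply_eq av havg c, Measure.map_map (measurable_const_mul g) (measurable_apply_bond c), hcoord,
    ← Measure.map_map (measurable_apply_bond c) (measurable_gaugeAct v), map_gaugeAct_imageLaw hj av havg v]

/-- **THE LAW OF A SINGLE COARSE BOND VARIABLE IS RIGHT-TRANSLATION INVARIANT** (the gauge transformation `g⁻¹` at `c₊`).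
[cite: Balaban1987RG1, (2.1) p.265] -/
theorem map_mul_right_bondLaw (hj : j + 1 ≤ P.m + P.K) (av : Averaging P j G) (havg : Measurable av.avg)
    (c : PBond P (j + 1)) (g : G) :
    ((fieldMeasure P j G).map (fun U => av.avg U c)).map (fun h => h * g) = (fieldMeasure P j G).map (fun U => av.avg U c) := by
  classical
  set v : GaugeTransf P (j + 1) G := fun y => if y = c.tgt then g⁻¹ else 1 with hv
  have hcoord : (fun h : G => h * g) ∘ (fun V : GaugeField P (j + 1) G => V c) =
      (fun V : GaugeField P (j + 1) G => V c) ∘ GaugeField.gaugeAct v := by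
    funext V
    simp only [Function.comp]
    rw [hv, gaugeAct_single_tgt_apply c g V]
  rw [map_avg_apply_eq av havg c, Measure.map_map (measurable_mul_const g) (measurable_apply_bond c), hcoord,
    ← Measure.map_map (measurable_apply_bond c) (measurable_gaugeAct v), map_gaugeAct_imageLaw hj av havg v]

omit [MeasurableMul₂ G] in
/-- The single-bond law is a probability measure. [cite: Balaban1985Averaging, (10) p.19] -/
theorem isProbabilityMeasure_bondLaw (av : Averaging P j G) (havg : Measurable av.avg) (c : PBond P (j + 1)) :
    IsProbabilityMeasure ((fieldMeasure P j G).map (fun U => av.avg U c)) :=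
  Measure.isProbabilityMeasure_map ((measurable_apply_bond c).comp havg).aemeasurable

end Generic

/-! ## §2 On a compact second-countable group: the single-bond law IS the Haar measure -/

section Haar

variable {G : Type*} [GaugeGroup G] [MeasurableSpace G]
  [TopologicalSpace G] [IsTopologicalGroup G] [CompactSpace G] [SecondCountableTopology G] [BorelSpace G]

/-- Uniqueness of the normalised Haar measure on a compact second-countable group: two left-invariant probability measures coincide
(both equal `haarMeasure ⊤`, `Measure.haarMeasure_unique`). [cite: BrockerTomDieck1985, I (5.12)] -/
theorem eq_of_isProbabilityMeasure_of_isMulLeftInvariant (μ ν : Measure G) [IsProbabilityMeasure μ] [IsProbabilityMeasure ν]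
    [μ.IsMulLeftInvariant] [ν.IsMulLeftInvariant] : μ = ν := by
  have hne : Nonempty G := ⟨1⟩
  have hμ := Measure.haarMeasure_unique μ (⊤ : TopologicalSpace.PositiveCompacts G)
  have hν := Measure.haarMeasure_unique ν (⊤ : TopologicalSpace.PositiveCompacts G)
  rw [TopologicalSpace.PositiveCompacts.coe_top, measure_univ, one_smul] at hμ hν
  rw [hμ, hν]

variable [HaarData G]

/-- The Haar data of `G` is the unique left-invariant probability measure: any left-invariant probability measure equals `HaarData.haar`.
[cite: BrockerTomDieck1985, I (5.12)] -/
theorem eq_haar_of_isMulLeftInvariant (μ : Measure G) [IsProbabilityMeasure μ] [μ.IsMulLeftInvariant] :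
    μ = (HaarData.haar : Measure G) := by
  haveI : IsProbabilityMeasure (HaarData.haar : Measure G) := HaarData.isProb
  haveI : (HaarData.haar : Measure G).IsMulLeftInvariant := ⟨fun g => HaarData.map_mul_left g⟩
  exact eq_of_isProbabilityMeasure_of_isMulLeftInvariant μ _

variable [MeasurableMul₂ G] {P : Params} {j : ℕ}

/-- **EVERY SINGLE COARSE BOND VARIABLE OF `Ū_*(dU)` IS EXACTLY HAAR DISTRIBUTED** — for EVERY covariant averaging of the standing range with
measurable `Ū` on a compact second-countable gauge group: `Law_{dU}(Ū(·)(c)) = Haar`.  (So exact Haar compatibility `Ū_*(dU) = dV` — NOT IN PRINT —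
concerns only the JOINT law of the coarse bond variables; print's sentence is [Balaban1987RG1] p. 265 on gauge covariance.) [cite: Balaban1987RG1, (2.1) p.265] -/
theorem bondLaw_eq_haar (hj : j + 1 ≤ P.m + P.K) (av : Averaging P j G) (havg : Measurable av.avg) (c : PBond P (j + 1)) :
    (fieldMeasure P j G).map (fun U => av.avg U c) = (HaarData.haar : Measure G) := by
  haveI := isProbabilityMeasure_bondLaw av havg c
  haveI : ((fieldMeasure P j G).map (fun U => av.avg U c)).IsMulLeftInvariant :=
    ⟨fun g => map_mul_left_bondLaw hj av havg c g⟩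
  exact eq_haar_of_isMulLeftInvariant _

/-- The `dU`-expectation of an integrable function of ONE coarse bond variable is its Haar integral: `∫ φ(Ū(U)(c)) dU = ∫ φ dHaar`.
[cite: Balaban1987RG1, (2.1) p.265] -/
theorem integral_comp_avg_apply (hj : j + 1 ≤ P.m + P.K) (av : Averaging P j G) (havg : Measurable av.avg) (c : PBond P (j + 1))
    (φ : G → ℝ) (hφ : AEStronglyMeasurable φ (HaarData.haar : Measure G)) :
    ∫ U, φ (av.avg U c) ∂(fieldMeasure P j G) = ∫ h, φ h ∂(HaarData.haar : Measure G) := by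
  have hmeas : Measurable fun U : GaugeField P j G => av.avg U c := (measurable_apply_bond c).comp havg
  rw [← bondLaw_eq_haar hj av havg c] at hφ ⊢
  exact (integral_map hmeas.aemeasurable hφ).symm

end Haar

/-! ## §3 By name: the T³ family's block averaging `blockAvg ℰp` on `SU(2)` -/

section T3

open T3ContinuumYM3Torus
open T3UnitLawDensityEML (ℰp measurableE_ℰp)

/-- `SU(2)` is second countable (closed subgroup of `M₂(ℂ)`; plumbing, as in `UnitaryModel` §4). [cite: BrockerTomDieck1985, I (1.10)] -/
private theorem secondCountableTopology_SU2 : SecondCountableTopology (Matrix.specialUnitaryGroup (Fin 2) ℂ) := by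
  haveI := secondCountableTopology_matrix (n := Fin 2)
  exact Topology.IsEmbedding.subtypeVal.secondCountableTopology

/-- **Every single coarse bond variable of the T³ family's `(0.4)`/`ℰp` block averaging is EXACTLY Haar distributed under `dU`**, at every level of
the standing range of every approximation `K` (whatever the truth of `T3AlphaInputsACTrivEnvelope.HaarCompatT3 F`, which asks this of the JOINT law).
[cite: Balaban1987RG1, (2.1) p.265] -/
theorem bondLaw_blockAvgEp_eq_haar (F : T3Family) (K j : ℕ) (hj : j + 1 ≤ F.m + K) (c : PBond (F.P K) (j + 1)) :
    (fieldMeasure (F.P K) j (Matrix.specialUnitaryGroup (Fin 2) ℂ)).map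
        (fun U => (BlockAveraging.blockAvg (P := F.P K) (j := j) ℰp).avg U c) =
      (HaarData.haar : Measure (Matrix.specialUnitaryGroup (Fin 2) ℂ)) := by
  haveI := secondCountableTopology_SU2
  exact bondLaw_eq_haar (P := F.P K) hj _ (BlockAveraging.measurable_avgFun _ measurableE_ℰp) c

/-- … hence the image law of the T³ family's block averaging is coarse-gauge invariant at every level of the standing range.
[cite: Balaban1987RG1, (2.1) p.265] -/
theorem map_gaugeAct_imageLaw_blockAvgEp (F : T3Family) (K j : ℕ) (hj : j + 1 ≤ F.m + K)
    (v : GaugeTransf (F.P K) (j + 1) (Matrix.specialUnitaryGroup (Fin 2) ℂ)) :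
    (((fieldMeasure (F.P K) j (Matrix.specialUnitaryGroup (Fin 2) ℂ)).map
        (BlockAveraging.blockAvg (P := F.P K) (j := j) ℰp).avg).map (GaugeField.gaugeAct v)) =
      (fieldMeasure (F.P K) j (Matrix.specialUnitaryGroup (Fin 2) ℂ)).map
        (BlockAveraging.blockAvg (P := F.P K) (j := j) ℰp).avg :=
  map_gaugeAct_imageLaw (P := F.P K) hj _ (BlockAveraging.measurable_avgFun _ measurableE_ℰp) v

end T3

/-! ## §4 «Laundering»: convolution with the Haar measure absorbs every finite measure

Why exactness of forests says nothing about cycles, and why a cycle holonomy can see a defect only if EVERY factor is defective: if independent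
group-valued variables `X`, `Y` have laws `Haar` and `ν`, the product `X·Y` has law `Haar ∗ₘ ν = ν(G)·Haar` — one exactly-Haar independent factor
makes the product exactly Haar.  (Folklore; recorded for the memo's defect-order count: the law of a cycle holonomy with conditionally independent
factors of laws `Haar + d_i`, `d_i(G) = 0`, differs from Haar by the convolution of ALL the `d_i`.) -/

section Launder

variable {G : Type*} [GaugeGroup G] [MeasurableSpace G] [HaarData G] [MeasurableMul₂ G]

/-- **`Haar ∗ₘ ν = ν(G) • Haar`** for every s-finite measure `ν` on the gauge group (right invariance of Haar + Tonelli). [cite: BrockerTomDieck1985, I (5.12)] -/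
theorem haar_mconv (ν : Measure G) [SFinite ν] :
    (HaarData.haar : Measure G) ∗ₘ ν = ν Set.univ • (HaarData.haar : Measure G) := by
  ext A hA
  have hind : Measurable (A.indicator (1 : G → ENNReal)) := measurable_const.indicator hA
  rw [← lintegral_indicator_one hA, Measure.lintegral_mconv hind, Measure.smul_apply, smul_eq_mul]
  have hF : Measurable (Function.uncurry fun (x y : G) => A.indicator (1 : G → ENNReal) (x * y)) :=
    hind.comp measurable_mul
  rw [lintegral_lintegral_swap hF.aemeasurable]
  have hinner : ∀ y : G, ∫⁻ x, A.indicator (1 : G → ENNReal) (x * y) ∂(HaarData.haar : Measure G) =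
      (HaarData.haar : Measure G) A := by
    intro y
    have hmeas : Measurable fun x : G => x * y := measurable_mul_const y
    calc ∫⁻ x, A.indicator (1 : G → ENNReal) (x * y) ∂(HaarData.haar : Measure G)
        = ∫⁻ z, A.indicator (1 : G → ENNReal) z ∂((HaarData.haar : Measure G).map fun x : G => x * y) :=
          (lintegral_map hind hmeas).symm
      _ = (HaarData.haar : Measure G) A := by rw [HaarData.map_mul_right, lintegral_indicator_one hA]
  simp_rw [hinner]
  rw [lintegral_const, mul_comm]

/-- **`ν ∗ₘ Haar = ν(G) • Haar`** for every s-finite measure `ν` (left invariance of Haar). [cite: BrockerTomDieck1985, I (5.12)] -/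
theorem mconv_haar (ν : Measure G) [SFinite ν] :
    ν ∗ₘ (HaarData.haar : Measure G) = ν Set.univ • (HaarData.haar : Measure G) := by
  ext A hA
  have hind : Measurable (A.indicator (1 : G → ENNReal)) := measurable_const.indicator hA
  rw [← lintegral_indicator_one hA, Measure.lintegral_mconv hind, Measure.smul_apply, smul_eq_mul]
  have hinner : ∀ x : G, ∫⁻ y, A.indicator (1 : G → ENNReal) (x * y) ∂(HaarData.haar : Measure G) =
      (HaarData.haar : Measure G) A := by
    intro x
    have hmeas : Measurable fun y : G => x * y := measurable_const_mul x
    calc ∫⁻ y, A.indicator (1 : G → ENNReal) (x * y) ∂(HaarData.haar : Measure G)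
        = ∫⁻ z, A.indicator (1 : G → ENNReal) z ∂((HaarData.haar : Measure G).map fun y : G => x * y) :=
          (lintegral_map hind hmeas).symm
      _ = (HaarData.haar : Measure G) A := by rw [HaarData.map_mul_left, lintegral_indicator_one hA]
  simp_rw [hinner]
  rw [lintegral_const, mul_comm]

/-- The product of two independent group elements one of which is Haar distributed is Haar distributed: `Haar ∗ₘ ν = Haar` for a probability
measure `ν`. [cite: BrockerTomDieck1985, I (5.12)] -/
theorem haar_mconv_of_isProbabilityMeasure (ν : Measure G) [IsProbabilityMeasure ν] :
    (HaarData.haar : Measure G) ∗ₘ ν = (HaarData.haar : Measure G) := by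
  rw [haar_mconv, measure_univ, one_smul]

/-- … and symmetrically `ν ∗ₘ Haar = Haar`. [cite: BrockerTomDieck1985, I (5.12)] -/
theorem mconv_haar_of_isProbabilityMeasure (ν : Measure G) [IsProbabilityMeasure ν] :
    ν ∗ₘ (HaarData.haar : Measure G) = (HaarData.haar : Measure G) := by
  rw [mconv_haar, measure_univ, one_smul]

end Launder

end Literature.MathematicalPhysics.QuantumFieldTheory.Balaban1983to89.AveragingImageLawGaugeInvariance

end
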